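import Mathlib.Data.Set.Card
import Mathlib.Data.Set.Finite.List
import Literature.Computability.Complexity.Classes
import Literature.Computability.Complexity.Nondeterministic
import Literature.Computability.Complexity.Reductions
import Literature.Computability.Complexity.ProbabilisticClasses
import Literature.Computability.Complexity.CircuitClasses
import Literature.Computability.MetaComplexity.MCSP
import HarnessLib

/-!
# Barrier catalogue `PneNP`: obstructions to proving `MCSP` NP-hard (Murray–Williams 2017;
Kabanets–Cai 2000; Ko 1991 and Hirahara–Watanabe 2016 as reported by Huang–Ilango–Ren 2023)

D-0021 barrier entry for the summit `PneNP`, bearing on the meta-complexity routes: PneNP/Circuit2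
(organising duality "`MCSP ∉ P/poly` is an instance of `NP ⊄ P/poly`", crux #2), PneNP/Ktlang
(crux #2: NP-hardness of a `K^t`-threshold language), PneNP/MetaCplx (#3 "no Heuristica"): the
step "prove the Minimum Circuit Size Problem NP-hard", which would derive hardness of
meta-complexity — and, through Hirahara's non-black-box reduction, average-case hardness of
`NP` — from `P ≠ NP`, is obstructed for the standard kinds of reductions.

**The printed results.**

* C. D. Murray, R. R. Williams, *On the (non) NP-hardness of computing circuit complexity*,
  Theory of Computing 13 (2017), art. 4 = CCC 2015 (held: `lit read
  paper:doi-10-4086-toc-2017-v013a004`, 20 PDF pages; NOTE: the held text extraction drops the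
  negation stroke of `≠`, `⊄`, `∉` — e.g. p. 2 "evidence that MCSP / ∈ P" — so Thms. 1.6–1.9
  print there with `=`, `⊂`; the readings below are the published ones, fixed by the surrounding
  prose: p. 2 "would still imply major separations of complexity classes. For example,
  `EXP ≠ ZPP` would follow, a major (embarrassingly) open problem", p. 14 "separation results
  that currently appear out of reach", p. 14 "We would like to strengthen Theorem 1.6 to show
  that the NP-hardness of MCSP actually implies circuit lower bounds such as `EXP ⊄ P/poly`"):
  - Def. 1.1 (p. 2): `TIME(t(n))` reductions — `R(x, i)` has random access to `x`, runs in
    `O(t(|x|))` time and outputs the `i`-th bit of an instance of polynomial length; "think of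
    `t(n)` as `n^{1-ε}`"; SAT, Vertex Cover, Independent Set, Hamiltonian Path, 3-Coloring are
    NP-complete under `TIME(poly(log n))` reductions (p. 3).
  - **Thm. 1.3** (p. 3, proof p. 10): "For every `δ < 1/2`, there is no `TIME(n^δ)` reduction
    from PARITY to MCSP. As a corollary, MCSP is not `AC⁰[2]`-hard under `TIME(n^δ)`
    reductions." **Thm. 1.5** (p. 3): the same for randomized `TIME(n^δ)` reductions, `δ < 1/5`.
  - **Thm. 1.6** (p. 14): "If MCSP is NP-hard under polynomial-time reductions, then
    `EXP ≠ NP ∩ P/poly`. Consequently, `EXP ≠ ZPP`." **Thm. 1.7** (p. 14): logarithmic-space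
    reductions give `PSPACE ≠ ZPP`. **Thm. 1.8** (p. 15): logtime-uniform `AC⁰` reductions give
    `NP ⊄ P/poly` and `E ⊄ i.o.-SIZE(2^{δn})` for some `δ > 0`, hence `P = BPP`. **Thm. 1.9**
    (p. 17): if `NMCSP` is `MA`-hard under polynomial-time reductions then `EXP ⊄ P/poly`.
  - **Thm. 4.1** (p. 14): "If every sparse language in `NP` has a polynomial-time reduction to
    MCSP, then `EXP ⊆ P/poly ⟹ EXP = NEXP`" (padding `L' = {x01^{2^{|x|^c}}}` of
    `L ∈ NTIME(2^{n^c})`; the reduction's output truth table is produced and all small circuits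
    checked in exponential time). (A language `L` is sparse if `|L ∩ {0,1}ⁿ| ≤ n^c + c`.)
  - Def. 3.2 (p. 8, Kabanets–Cai): a reduction to MCSP is *natural* if "the size of all output
    instances and the size parameters `k` depend only on the length of the input"; Claim 3.3:
    a `TIME(t(n))` reduction from PARITY becomes natural with `k = Õ(t(n))`; §1 (p. 2):
    Kabanets–Cai show that NP-completeness under natural reductions gives `EXP ⊄ P/poly`, and
    `E ⊄ SIZE(2^{εn})` for some `ε > 0` unless `NP ⊆ SUBEXP`.
  - §1.1 (p. 4), the mechanism: "instances of MCSP are written in a rather non-succinct way: the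
    entire truth table of the function is provided ... the efficient reduction `R` itself yields
    a strong upper bound on the witness sizes of the outputs of `R`."
  - Conclusion (p. 19): "While we have proven consequences if MCSP is NP-hard under general
    polynomial-time reductions, we have none if it is hard under polynomial-time randomized
    reductions"; conjectured: MCSP is unconditionally not NP-hard under logtime-uniform `AC⁰`
    reductions.
* Y. Huang, R. Ilango, H. Ren, *NP-hardness of approximating meta-complexity: a cryptographic
  approach*, STOC 2023 (held: `paper:doi-10-1145-3564246-3585154`): p. 3 "Kabanets and Cai [57]
  ... show that if MCSP is NP-complete under 'natural' reductions, then `E` does not have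
  polynomial-size circuits. Murray and Williams [72] show that any deterministic many-one
  reduction from SAT to MCSP implies a breakthrough complexity separation: `EXP ≠ ZPP`. Note
  that both these results have consequences that we believe but seem hard to show"; p. 3
  (Eliminating Heuristica): NP-hardness of the approximation version of MCSP would, via
  Hirahara's non-black-box worst-case-to-average-case reduction, rule out Heuristica; §4 (p. 12)
  "There are mainly two barriers to showing NP-hardness of meta-complexity problems:
  relativisation [62] and oracle independence [46]. Ko [62] showed that any NP-hardness result
  for MINLT ... must be non-relativising. This relativisation barrier was overcome by [42] using
  non-relativising techniques such as the PCP theorem. ... [46] showed that under plausible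
  assumptions, NP-hardness of MCSP cannot be established via oracle-independent reductions.
  Hirahara's results [42] are subject to this barrier"; p. 8: "essentially the same proof as in
  [72] shows that if MOCSP is NP-hard under deterministic polynomial-time reductions, then
  `EXP ≠ ZPP`" (Ilango).
* Tree: `Literature.Computability.MetaComplexity.MCSP` (truth table paired with the size bound in binary,
  `Literature/Computability/MetaComplexity/MCSP.lean`), `Literature.Computability.Complexity.isRandNPHard_MCSPStar`
  (Hirahara 2022, Thm. 1.2: `MCSP*` is NP-hard under randomized reductions) and
  `Literature.Computability.Complexity.kabanets_cai_MCSP_mem_P` in `Literature/Computability/Complexity/MCSPHardness.lean`.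

**What this file adds.** The Karp technique class is the tree's `Literature.CplxCore.IsNPHard MCSP`;
sparse languages (`IsSparseLanguage`, MW §4.1) are defined here. Murray–Williams Thm. 4.1 and the
first sentence of Thm. 1.6 are vendored as named facts (`MurrayWilliams2017_thm_4_1`, the
barrier fact `MCSPKarpHardness`), and Thm. 1.6's "Consequently, `EXP ≠ ZPP`" is PROVED from the
fact and the class inclusions `ZPP ⊆ RP ⊆ NP ∩ BPP`, `BPP ⊆ P/poly`, `NP ⊆ EXP` (tree facts, fed
as hypotheses: `MCSPKarpHardness.exp_ne_zpp`), together with the `¬`-reading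
`MCSPKarpHardness.not_isNPHard_of_exp_eq`. The local-reduction theorems (1.3, 1.5) and the
logspace / uniform-`AC⁰` theorems (1.7, 1.8) are quoted, not formalised (scope_caveats).

## Sources

* [MurrayWilliams2017] PDF pp. 2–4 (§1, Def. 1.1, Thms. 1.3, 1.5, §1.1), p. 8 (Def. 3.2,
  Claim 3.3), p. 10 (proof of Thm. 1.3), pp. 13–15 (§4, Thms. 1.6, 1.7, 4.1, 1.8), p. 17
  (Thm. 1.9), p. 19 (conclusion) — held.
* [HuangIlangoRen2023] PDF p. 3, p. 8, p. 12 (§4) — held.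
* [Hirahara2022] Thm. 1.2 — tree key (through `MCSPHardness.lean`).
* [KabanetsCai2000] — text not held (acq-00153); quoted only through [MurrayWilliams2017] §1,
  Def. 3.2 and [HuangIlangoRen2023] p. 3.
-/

noncomputable section

namespace Literature.Barriers.PneNP

open _root_.Computability Literature.Computability.Complexity Literature.Computability.Complexity.Nondeterministic Literature.Computability.MetaComplexity
open scoped Literature.Computability.Complexity.Notation

/-! ### Sparse languages and Theorem 4.1 -/

/-- A language `L ⊆ {0,1}*` is **sparse** if for some `c`, `|L ∩ {0,1}ⁿ| ≤ n^c + c` for all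
`n` (Murray–Williams §4.1: "a language `L` is sparse if there is a `c` such that for all `n`,
`|L ∩ {0,1}ⁿ| ≤ n^c + c`"). [cite: MurrayWilliams2017, §4.1 (p. 14)] -/
def IsSparseLanguage (L : Language Bool) : Prop :=
  ∃ c : ℕ, ∀ n : ℕ, {x : List Bool | x ∈ L ∧ x.length = n}.ncard ≤ n ^ c + c

/-- The slices `L ∩ {0,1}ⁿ` are finite, so `Set.ncard` above is the honest cardinality.
[folklore] -/
theorem finite_slice (L : Language Bool) (n : ℕ) : {x : List Bool | x ∈ L ∧ x.length = n}.Finite :=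
  (List.finite_length_eq Bool n).subset fun _ hx => hx.2

/-- The empty language is sparse. [folklore] -/
theorem isSparseLanguage_zero : IsSparseLanguage (0 : Language Bool) :=
  ⟨0, fun n => by
    have : {x : List Bool | x ∈ (0 : Language Bool) ∧ x.length = n} = ∅ :=
      Set.eq_empty_of_forall_notMem fun x hx => hx.1
    rw [this, Set.ncard_empty]
    exact Nat.zero_le _⟩

/-- A sublanguage of a sparse language is sparse. [folklore] -/
theorem IsSparseLanguage.mono {L L' : Language Bool} (h : IsSparseLanguage L)
    (hL' : ∀ x ∈ L', x ∈ L) : IsSparseLanguage L' := by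
  obtain ⟨c, hc⟩ := h
  refine ⟨c, fun n => le_trans (Set.ncard_le_ncard ?_ (finite_slice L n)) (hc n)⟩
  exact fun x hx => ⟨hL' x hx.1, hx.2⟩

/-- **Murray–Williams 2017, Thm. 4.1.** "If every sparse language in `NP` has a
polynomial-time reduction to MCSP, then `EXP ⊆ P/poly ⟹ EXP = NEXP`." (Proof in print: pad
`L ∈ NTIME(2^{n^c})` to the sparse `NP` language `{x01^{2^{|x|^c}}}`, reduce it to MCSP; under
`EXP ⊆ P/poly` the produced truth tables have polynomial-size circuits, so exhaustive search over
small circuits decides `L` in exponential time.) Named fact over the tree's `MCSP`, `≤ₚ`, `EXP`,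
`NEXP`, `PPoly`. [cite: MurrayWilliams2017, Thm. 4.1 (p. 14)] -/
def MurrayWilliams2017_thm_4_1 : Prop :=
  (∀ L ∈ NP, IsSparseLanguage L → L ≤ₚ MCSP) → EXP ⊆ PPoly → EXP = NEXP

/-- Karp NP-hardness of `MCSP` supplies the hypothesis of Thm. 4.1 (every `NP` language, in
particular every sparse one, reduces). [cite: MurrayWilliams2017, §4.1 (p. 14: "it suffices that MCSP is hard for only sparse languages in NP")] -/
theorem forall_sparse_reducible_of_isNPHard (h : IsNPHard MCSP) :
    ∀ L ∈ NP, IsSparseLanguage L → L ≤ₚ MCSP :=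
  fun L hL _ => h L hL

/-! ### The barrier fact: Theorem 1.6 -/

/-- **Murray–Williams 2017, Thm. 1.6: "If MCSP is NP-hard under polynomial-time reductions, then
`EXP ≠ NP ∩ P/poly`. Consequently, `EXP ≠ ZPP`."** Vendored: the first sentence, for the tree's
`MCSP` and Karp hardness `IsNPHard` (every `NP` language many-one reduces in deterministic
polynomial time); the consequence `EXP ≠ ZPP` is proved below (`exp_ne_zpp`).

BARRIER
technique_class: np-hardness-reductions, karp-reductions, deterministic-many-one-reductions, local-reductions, gadget-reductions, natural-reductions-to-mcsp, mcsp, meta-complexity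
blocks: establishing NP-hardness of the Minimum Circuit Size Problem — the step that would make hardness of meta-complexity (route PneNP/Circuit2 crux #2 `MCSP ∉ P/poly` as an instance of `NP ⊄ P/poly`; route PneNP/Ktlang crux #2; via Hirahara's non-black-box reduction also route PneNP/MetaCplx #3, "eliminating Heuristica" [cite: HuangIlangoRen2023, p. 3]) a consequence of `P ≠ NP` — by the standard kinds of reductions: (i) NO `TIME(n^δ)` local reduction, `δ < 1/2`, even from PARITY to MCSP exists (unconditional; randomized local reductions: `δ < 1/5`), whereas SAT, Vertex Cover, Hamiltonian Path, 3-Coloring are NP-complete under `TIME(polylog n)` reductions [cite: MurrayWilliams2017, Thms. 1.3, 1.5 and Thm. 1.2 (p. 3)]; (ii) a deterministic polynomial-time many-one reduction (`IsNPHard MCSP`) gives `EXP ≠ NP ∩ P/poly` and `EXP ≠ ZPP` (this fact; `MCSPKarpHardness.exp_ne_zpp`), a logspace one `PSPACE ≠ ZPP`, a logtime-uniform `AC⁰` one `NP ⊄ P/poly` and `P = BPP` [cite: MurrayWilliams2017, Thms. 1.6, 1.7, 1.8 (pp. 14–15)]; (iii) a "natural" reduction (output length and size parameter depending only on the input length)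 gives `EXP ⊄ P/poly`-type circuit lower bounds (Kabanets–Cai), as reported in [cite: MurrayWilliams2017, §1 (p. 2) and Def. 3.2 (p. 8)] [cite: HuangIlangoRen2023, p. 3].
because: "instances of MCSP are written in a rather non-succinct way: the entire truth table of the function is provided", so an efficient reduction bounds the circuit complexity of its own outputs [cite: MurrayWilliams2017, §1.1 (p. 4)]: a `TIME(n^δ)` reduction from PARITY can be padded into a natural one with parameter `k = Õ(n^δ)` (Claim 3.3), and guessing the witness circuit then gives depth-three `2^{Õ(n^δ)}`-size circuits for PARITY, contradicting Håstad for `δ < 1/2` [cite: MurrayWilliams2017, Claim 3.3 (p. 8) and proof of Thm. 1.3 (p. 10)]; for polynomial-time reductions, hardness of MCSP for the sparse padded versions of `NTIME(2^{n^c})` languages together with `EXP ⊆ P/poly` puts `NEXP` inside `EXP` (Thm. 4.1, `MurrayWilliams2017_thm_4_1`), which is incompatible with `EXP = NP ∩ P/poly` by the nondeterministic time hierarchy [cite: MurrayWilliams2017, §4.1 (p. 14)].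
evasions_known: RANDOMIZED reductions are outside every printed consequence — "we have none if it is hard under polynomial-time randomized reductions" [cite: MurrayWilliams2017, §6 (p. 19)] — and that is how NP-hardness IS proved for variants: partial-function `MCSP*` under randomized reductions (tree fact `Literature.Computability.Complexity.isRandNPHard_MCSPStar`) [cite: Hirahara2022, Thm. 1.2], conditional `MOCSP` and approximation versions by cryptographic constructions [cite: HuangIlangoRen2023, p. 8 and §4 (p. 12)]; the relativisation barrier for meta-complexity NP-hardness (Ko, for MINLT) "was overcome by [Hirahara] using non-relativising techniques such as the PCP theorem" [cite: HuangIlangoRen2023, §4 (p. 12)]; still uncovered by any evasion: oracle-independent reductions cannot establish NP-hardness of MCSP under plausible assumptions (Hirahara–Watanabe), and Hirahara's and Huang–Ilango–Ren's reductions are oracle-independent [cite: HuangIlangoRen2023, §4 (p. 12)]. NARROWED (barrier audit 2026-08-16; `MCSPKarpHardnessNarrow` in `MCSPHardnessObstructionsScope.lean`, evasions (E1)–(E6)): also outside every printed consequence are general ADAPTIVE polynomial-time Turing reductions ("Nothing was known so far about consequences of NP-hardness of MCSP under general Turing reductions" [cite: SaksSanthanam2020, Abstract (p. 26:1) and §5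 (p. 26:11)]; truth-table and polylog-round Turing reductions DO give `EXP ≠ ZPP` [cite: HitchcockPavan2015, Cor. 4.4 and Thm. 4.5 (p. 244)], parametric-honest / natural Turing reductions `E ⊄ SIZE(poly)` [cite: SaksSanthanam2020, Thms. 1–2 (pp. 26:2–26:3)]), NON-UNIFORM reductions (in the excluded world every `NP` language reduces to `MCSP` by a polynomial-time map with polynomial advice, `advice_reducible_MCSP_of_world`, so uniformity of `R` is load-bearing in Thm. 4.1; positively "MKTP is hard for the complexity class DET under non-uniform NC⁰ reductions" [cite: AllenderHirahara2017, Abstract (p. 54:1) and §1 (p. 54:3)]), NON-BLACK-BOX arguments ("if one-way functions exist, then MCSP ∈ P if and only if P = NP"; under iO "MCSP ∈ ZPP if and only if NP = ZPP ... a non-black box reduction from SAT to MCSP" [cite: HuangIlangoRen2023, §1.2 (p. 4)]) and CONDITIONAL hardness under hypotheses that already imply the consequence (subexponentially-secure SNARGs give NP-hardness of Gap-mvMCSP "under deterministic quasi-polynomial time reductions" [cite: HuangIlangoRen2023, Cor. 2.5 (p. 9)]; [cite: HiraharaIlango2025]); and for ZPP-Turing reductions no analogue of Thm. 1.6 is provable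 short of its consequence, since "If `Γ ⊆ P/poly`, then `Γ ⊆ ZPP^{MCSP}`" for `Γ = EXP` puts `NP = EXP` inside `ZPP^{MCSP}` in the excluded world [cite: ImpagliazzoKabanetsVolkovich2018, Thm. 1 (p. 7:2)].
scope_caveats: an "implies a breakthrough" obstruction for polynomial-time reductions, not an impossibility — `EXP ≠ ZPP`, `EXP ⊄ P/poly` are "consequences that we believe but seem hard to show" [cite: HuangIlangoRen2023, p. 3], and MW themselves aim to strengthen Thm. 1.6 to circuit lower bounds [cite: MurrayWilliams2017, §4.1 (p. 14)]; only the local-reduction statements (Thms. 1.3, 1.5) are unconditional no-go theorems, and they are NOT formalised here (they need sublinear-time random-access reductions, Def. 1.1; likewise Thm. 1.7's logspace and Thm. 1.8's logtime-uniform `AC⁰` reductions are not in the tree) — the formal content is Thm. 1.6 (first sentence, named fact; consequence proved) and Thm. 4.1 (named fact); the tree's `MCSP` pairs the truth table with the size bound in binary by `boolPair`, MW's encodings concatenate them (unary or binary `k`, inter-reducible in `TIME(poly(log n))`, Prop. 2.2, "results ... hold for either reduction model", p. 5) — the transfer of Thm. 1.6 along the polynomial-time translation between these encodings is not formalised; the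 held text of [MurrayWilliams2017] renders `≠`/`⊄` without the stroke, readings restored from the prose (module docstring). REACH (barrier audit 2026-08-16): the excluded world is exactly `W : NP = EXP ∧ EXP ⊆ P/poly` (given `NP ⊆ EXP`; `MCSPKarpHardness.world_iff`, `MCSPKarpHardness.iff_not_isNPHard_of_world` in `MCSPHardnessObstructionsScope.lean`), and `¬W` already follows from `NP ⊄ P/poly`, from `NP ≠ coNP` and from `P = NP` (`MCSPKarpHardness.not_world_of_not_NP_subset_PPoly`, `…of_NP_ne_coNP`, `…of_P_eq_NP`) — so the fact prices the ORDER of steps inside a route (Karp-hardness of `MCSP` cannot come before a statement of strength `¬W`) and does NOT bear on route PneNP/Circuit2's duality `MCSP ∉ P/poly ↔ NP ⊄ P/poly` (TRUE in `W`, `MCSPKarpHardness.duality_of_world`; its non-trivial direction wants non-uniform hardness, which Thm. 1.6 does not touch), nor on an implication `NP ⊄ P/poly → IsNPHard MCSP`, nor on route PneNP/Ktlang's randomized `K^t` crux; the `technique_class:` line above is too broad (`np-hardness-reductions`, `gadget-reductions`, `mcsp`, `meta-complexity`) — read it as the narrowed class of `MCSPKarpHardnessNarrow`: deterministic, UNIFORM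 reductions of bounded adaptivity (many-one, truth-table, polylog-round / natural / parametric-honest / oracle-independent Turing, sublinear-local, logspace, uniform `AC⁰`) [cite: SaksSanthanam2020, §5 (p. 26:11)]; the locus "§6 (p. 19)" above is §5 (Conclusion) of the ToC version, PDF pp. 18–19; the fact itself is PROVED in the tree (`MCSPKarpHardness_holds`, `MCSPHardnessObstructionsProofs.lean`; Thm. 4.1 `MurrayWilliams2017_thm_4_1_holds`).
status: established [cite: MurrayWilliams2017, Thms. 1.3, 1.6, 4.1] -/
def MCSPKarpHardness : Prop :=
  IsNPHard MCSP → EXP ≠ NP ∩ PPoly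

/-! ### "Consequently, `EXP ≠ ZPP`" (proved from the fact) -/

/-- `ZPP ⊆ NP ∩ P/poly`, from `ZPP = RP ∩ coRP ⊆ RP`, `RP ⊆ NP`, `RP ⊆ BPP ⊆ P/poly` (tree facts
`RP_subset_NP`, `RP_subset_BPP`, `BPP_subset_PPoly` as hypotheses).
[cite: MurrayWilliams2017, §4.1 (p. 14: "Consequently, EXP ≠ ZPP")] -/
theorem zpp_subset_np_inter_ppoly (hRPNP : RP_subset_NP) (hRPBPP : RP_subset_BPP)
    (hBPP : BPP_subset_PPoly) : ZPP ⊆ NP ∩ PPoly := fun _ hL =>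
  ⟨hRPNP hL.1, hBPP (hRPBPP hL.1)⟩

/-- **Murray–Williams Thm. 1.6, second sentence: Karp NP-hardness of `MCSP` gives `EXP ≠ ZPP`.**
From the fact: if `EXP = ZPP` then `EXP ⊆ ZPP ⊆ NP ∩ P/poly ⊆ NP ⊆ EXP`, so `EXP = NP ∩ P/poly`,
contradicting Thm. 1.6. Class inclusions enter as the tree's named facts.
[cite: MurrayWilliams2017, Thm. 1.6 (p. 14)] -/
theorem MCSPKarpHardness.exp_ne_zpp (h : MCSPKarpHardness) (hRPNP : RP_subset_NP)
    (hRPBPP : RP_subset_BPP) (hBPP : BPP_subset_PPoly) (hNPEXP : NP_subset_EXP)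
    (hhard : IsNPHard MCSP) : EXP ≠ ZPP := by
  intro hEZ
  apply h hhard
  refine Set.Subset.antisymm ?_ fun L hL => hNPEXP hL.1
  rw [hEZ]
  exact zpp_subset_np_inter_ppoly hRPNP hRPBPP hBPP

/-- The `¬`-reading: in a world with `EXP = NP ∩ P/poly` (e.g. `EXP = ZPP`), `MCSP` is not
NP-hard under Karp reductions. [cite: MurrayWilliams2017, Thm. 1.6 (p. 14)] -/
theorem MCSPKarpHardness.not_isNPHard_of_exp_eq (h : MCSPKarpHardness) (hE : EXP = NP ∩ PPoly) :
    ¬ IsNPHard MCSP :=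
  fun hhard => h hhard hE

/-- Thm. 1.6 is how Thm. 4.1 is used: under Karp NP-hardness of `MCSP`, `EXP ⊆ P/poly` already
forces `EXP = NEXP`. [cite: MurrayWilliams2017, Thm. 4.1 and §4.1 (p. 14)] -/
theorem exp_eq_nexp_of_isNPHard (h41 : MurrayWilliams2017_thm_4_1) (hhard : IsNPHard MCSP)
    (hEXP : EXP ⊆ PPoly) : EXP = NEXP :=
  h41 (forall_sparse_reducible_of_isNPHard hhard) hEXP

end Literature.Barriers.PneNP

end
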